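import Mathlib.Tactic.Linarith
import Mathlib.Tactic.Ring
import Mathlib.Tactic.NormNum
import Mathlib.Tactic.IntervalCases
import Mathlib.Data.Nat.Factorial.Basic
import HarnessLib

/-!
# The (0,1) cell of the ι-window, EXCLUSION side, VII: the Quot-dimension sieve at a type-A fixed point FOR ALL n —
# structure theorem (class Z) and the (RDP⁺) transversality criterion; arithmetic skeleton

Family `hodge`, b2b cell `hweil`, `Summits/HodgeConjecture/HodgeConjecture/Theorems` (helper of item stmt-HodgeConjecture-2524, the Weil-sixfold rung the H2 test serves). Companion to the Literature files `SemiregularityQuotSieveFixedNode.lean` (pv1-g16: THEOREM A/B,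
the uniform sieve 14.3 for `n ≤ 3`), `SemiregularityThetaSecondFundamentalForm.lean` (pv1-g17: THEOREM 1–3, the residual (W)⁗) and
`SemiregularityThetaNormality.lean` (pv1-g18: THEOREM N), SAME dictionary: `X` a very general ppav fourfold, `Θ` symmetric, `ι = −1`,
`S_a = Θ_a ∩ Θ_{−a}`, `x` an `ι`-fixed singular point of `S_a` of type `A_{2m−1}`, `A = k[[x₁,…,x₄]]` (all coordinates odd), `M = F′_x` the
canonical hull — one of six types `M_𝔞`, `M⁰`, NB, `+`, `−`, `d` with minimal generators of signs `(m₊, m₋)` and minimal relations of signs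
`(ρ₊, ρ₋)` — and `Q = Quot^ι_x(M; n, n)` the punctual `ι`-Quot scheme of balanced quotients `T₀ = M/F` of length `2n`; `d(F)` the local dimension
of `Q` at `[F]`; `a_ε = dim (T₀/𝔪T₀)_ε`, `s_ε = dim soc(T₀)_ε`, `μ_ε(F) = dim (F/𝔪F)_ε`. Ladder note `papers/HodgeConjecture/hodge-weil-ladder`
(packet `run/shared/lean/b2b/hodge-weil/`), CLAIM TABLE v27 (LADDER C180) row pv1 carried, report `b2b-hweil-pv1-g19/H2-ZERO-ONE-7.md`. Def-free,
fully proved ELEMENTARY statements (integer / rational bookkeeping); the module theory and the geometry are in the docstrings and the report.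
HONEST FRAMING: census / structure results about one cell of the ladder's H2 test on the exclusion side; no case of the Hodge conjecture is proved;
nothing here is a rung; no statement of [Markman 2025] is used; nothing here depends on (LP) or on 'ker ob = ann(ch)'.

LEMMA S⁺ (report §1; the socle pencils sweep): for a sign `σ` with `s_σ ≥ 1` and `μ_σ(F) ≥ 1`, `d(F) ≥ μ_σ(F) + s_σ − 1` (the `ℙ^{μ_σ}`-pencils
over `ℙ(soc_σ)` are pairwise disjoint off `[F]`): `socleSweep_survivor`. With `μ(F) ≥ 3` (`F ⊂ E` of rank 2 is never free: `mu_ge_three_excludes_twoSigned`)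
a point with `d ≤ 1` has single-signed socle. PROPOSITION G (report §2): for a balanced quotient with SIMPLE socle, Matlis duality gives
`End_A(T₀) = A/Ann(T₀)` of dimension `2n` and `End^ι = (A/J)_{even}` of dimension exactly `n` (`endDim_simpleSocle`), while the parameter count from a
minimal presentation gives `hom^ι(M, T₀) ≥ n(μ − β₁) + Σ_k a_{ρ_k}` (`homCount_lower`); so `(P)` yields `d ≥ n(μ − β₁ − 1) + Σ_k a_{ρ_k}`, i.e.
`2(a₊ + a₋) ≥ 2` on `M_𝔞`/`±`, `n + a₋ ≥ 2` on `M⁰`, `n + a₊ + a₋ ≥ 3` on NB, and only `3(a₊+a₋) − n` on type `d` (`propG_*`). PROPOSITION C (cyclic quotients,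
all `n`; `propC_*`). THEOREM S (report §4): a point with `d ≤ 1` is of CLASS Z — socle single-signed `σ` of dimension `≥ 2`, `μ_σ(F) = 0`, `a_σ = m_σ`
(`classZ_top`), not cyclic, Loewy length `≥ 3` for `n ≥ 4` (`noLoewyTwo`) — or, on type `d`, Gorenstein with `3(a₊+a₋) ≤ n + 1`. Consequence: (W)⁗ shrinks to
(W)⁗_Z. Class Z is NOT shown empty; report §5 records what (P) gives there (`classZ_decomposable_plus/minus`, `example_141`) and §6 a machine census.

PROPOSITION R (report §7; the (RDP⁺) side): at a non-fixed corank-2 singular point of `S_a` (rank `B = 1`, `B = II_u − II_v` on the pair incidence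
`I ⊂ Θ ×_{ℙ³} Θ`), the derivative of `B` along the diagonal kernel direction `(k,k)`, restricted to `K = ker B`, is the POLAR of the cubic term `C` of the
singularity on `K`; hence a reduced point of the degeneracy scheme `{rank B ≤ 1}` has `C ∉ {ℓ³, 0}` (`binaryCubic_polar_injective_*` vs. the cube, whose
polar map has rank `≤ 1`) and the singularity is `D_k`, rational: (RDP⁺) ⟸ (RDP⁺)′. Enumerative frame: the universal Harris–Tu coefficient is `20`
(`harrisTu_on_pairs`, as in THEOREM 2), `deg γ = 4! = 24`, the pair incidence has degree `24·23 − 24 = 528` over `ℙ³`, virtual count `20·528 = 10560`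
before the excess of the fold divisor (`pairIncidence_degree`). The budget remark `Σ_w p_g(w) ≤ 14` (`pg_budget`).

What is NOT here: modules, Quot schemes, theta functions, the proofs (report §§1–7), class Z's emptiness, (RDP⁺), (RDP⁺)′, the excess term. 0 unconditional
rungs above the floor.
-/

namespace Summit.HodgeConjecture.HodgeConjecture.WeilTypeLadder

section H2QuotSieveAllN

/-- LEMMA S⁺, the survivor condition (report §1.1 and 1.1 (b)): the socle-pencil family through `[F]` for a socle sign `σ` has dimension
`μ_σ(F) + s_σ − 1` as soon as `μ_σ(F) ≥ 1`; a point of local dimension `≤ 1` with `μ_σ(F) ≥ 1` therefore has `μ_σ(F) = 1` AND simple `σ`-socle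
`s_σ = 1`. [H2-ZERO-ONE-7 §1] -/
theorem socleSweep_survivor (μ s : ℕ) (hs : 1 ≤ s) (hμ : 1 ≤ μ) (hd : μ + s - 1 ≤ 1) : μ = 1 ∧ s = 1 := by
  omega

/-- LEMMA 1.2 + S⁺ (report §1.2, §4.1 first step): `F ⊂ E` has rank `2` and is not free (its cokernel is supported on the surface `S`, not on a
hypersurface), so `μ(F) = μ₊(F) + μ₋(F) ≥ 3`; if both signs occurred in `soc T₀` at a point with `d ≤ 1`, S⁺ would give `μ₊(F) ≤ 1` and `μ₋(F) ≤ 1` —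
impossible. Hence the socle of a survivor is single-signed. [H2-ZERO-ONE-7 §1, §4] -/
theorem mu_ge_three_excludes_twoSigned (μp μm : ℕ) (h3 : 3 ≤ μp + μm) (hp : μp ≤ 1) (hm : μm ≤ 1) : False := by
  omega

/-- LEMMA 2.1, the `(P)`-count from a minimal presentation (report §2.1): with `μ` generators and `β` relations, all relation coefficients in `𝔪`,
and `T₀` balanced (each sign part of dimension `n`), `Hom_A(M,T₀)^ι` is cut out of `μ·n` unknowns by at most `Σ_k (n − a_{ρ_k})` conditions
(the `k`-th relation takes values in `(𝔪T₀)_{ρ_k}`, of dimension `n − a_{ρ_k}`); the identity `μn − (βn − A) = n(μ − β) + A` with `A = Σ_k a_{ρ_k}`.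
[H2-ZERO-ONE-7 §2.1; H2-EXISTENCE-SIDE-2 §1.2 (P)] -/
theorem homCount_lower (μ β n A : ℤ) : μ * n - (β * n - A) = n * (μ - β) + A := by
  ring

/-- LEMMA 2.2 (report §2.2; Matlis duality, Bruns–Herzog §3.2–3.3): a finite-length module with SIMPLE socle is the dual of a cyclic one,
`T₀ ≅ (A/J)^∨`, `End_A(T₀) ≅ A/J` has dimension `ℓ(T₀) = 2n`, and the `ι`-invariant endomorphisms are the EVEN elements of `A/J`; `A/J ≅ T₀^∨` is
balanced, so its even part has dimension `n`: `dim End^ι(T₀) = n` exactly. Arithmetic: even + odd `= 2n`, even `=` odd ⟹ even `= n`.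
[H2-ZERO-ONE-7 §2.2] -/
theorem endDim_simpleSocle (e o n : ℕ) (htot : e + o = 2 * n) (hbal : e = o) : e = n := by
  omega

/-- PROPOSITION G for `M_𝔞` (report §2.3): `(μ, β₁) = (5, 4)`, relation signs `(2₊, 2₋)`; `d ≥ n(μ − β₁ − 1) + 2a₊ + 2a₋ = 2(a₊ + a₋) ≥ 2`
for every `n` (a quotient has `a₊ + a₋ ≥ 1` generators). No hypothesis on the base ideal `𝔞`. [H2-ZERO-ONE-7 §2.3] -/
theorem propG_Ma (n ap am : ℤ) (ha : 1 ≤ ap + am) : 2 ≤ n * (5 - 4 - 1) + (2 * ap + 2 * am) := by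
  have h0 : n * (5 - 4 - 1) = 0 := by ring
  linarith

/-- PROPOSITION G for `M⁰` (report §2.3): `(μ, β₁) = (3, 1)`, one relation of sign `−`; `d ≥ n + a₋ ≥ 2` for `n ≥ 2`. [H2-ZERO-ONE-7 §2.3] -/
theorem propG_M0 (n am : ℤ) (hn : 2 ≤ n) (ha : 0 ≤ am) : 2 ≤ n * (3 - 1 - 1) + am := by
  have h1 : n * (3 - 1 - 1) = n := by ring
  linarith

/-- PROPOSITION G for the non-Cartier type NB (report §2.3): `(μ, β₁) = (4, 2)`, relation signs `(1₊, 1₋)`; `d ≥ n + a₊ + a₋ ≥ 3`.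
[H2-ZERO-ONE-7 §2.3; hull data H2-ZERO-ONE-4 14.4] -/
theorem propG_NB (n ap am : ℤ) (hn : 2 ≤ n) (ha : 1 ≤ ap + am) : 3 ≤ n * (4 - 2 - 1) + (ap + am) := by
  have h1 : n * (4 - 2 - 1) = n := by ring
  linarith

/-- PROPOSITION G for the non-Cartier types `+` and `−` (report §2.3): `(μ, β₁) = (5, 4)`, relation signs `(2, 2)`; `d ≥ 2(a₊ + a₋) ≥ 2`, as
for `M_𝔞`. [H2-ZERO-ONE-7 §2.3] -/
theorem propG_pm (n ap am : ℤ) (ha : 1 ≤ ap + am) : 2 ≤ n * (5 - 4 - 1) + (2 * ap + 2 * am) := by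
  have h0 : n * (5 - 4 - 1) = 0 := by ring
  linarith

/-- PROPOSITION G for the most degenerate non-Cartier type `d` (report §2.3, §2.4 (d)): `(μ, β₁) = (6, 6)`, relation signs `(3, 3)`; the crude
count only gives `d ≥ 3(a₊ + a₋) − n`, which is `≥ 2` iff `3(a₊ + a₋) ≥ n + 2` — the type-`d` Gorenstein alternative of THEOREM S.
[H2-ZERO-ONE-7 §2.3] -/
theorem propG_d (n ap am : ℤ) :
    n * (6 - 6 - 1) + (3 * ap + 3 * am) = 3 * (ap + am) - n ∧ (n + 2 ≤ 3 * (ap + am) → 2 ≤ 3 * (ap + am) - n) := by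
  refine ⟨by ring, ?_⟩
  intro h; linarith

/-- PROPOSITION C, the `(P)` half (report §3 = H2-ZERO-ONE-4 14.3 for all `n`): a CYCLIC quotient generated in sign `σ` has `aut^ι = n` and
`hom^ι ≥ n(μ − β₁) + ρ_σ`, so `d ≥ n(μ − β₁ − 1) + ρ_σ`: `= 2` on `M_𝔞`/`±` (`ρ_σ = 2`), `≥ n` on `M⁰`, `= n + 1` on NB. [H2-ZERO-ONE-7 §3] -/
theorem propC_P (n : ℤ) (hn : 2 ≤ n) :
    n * (5 - 4 - 1) + 2 = 2 ∧ 2 ≤ n * (3 - 1 - 1) + 0 ∧ 2 ≤ n * (4 - 2 - 1) + 1 := by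
  refine ⟨by ring, ?_, ?_⟩ <;> nlinarith

/-- PROPOSITION C, the `(Ψ)` half for type `d` (and any hull with `m_σ ≥ 3`, `m_τ ≥ 2`): the last Loewy layer of a cyclic `T₀` of length `2n ≥ 4`
lies in `soc(𝔪T₀)`, so one of `s_σ(𝔪T₀)`, `s_τ(𝔪T₀)` is `≥ 1` and `h_Ψ = (m_σ − 1)s_σ + m_τ s_τ ≥ 2` with `(m_σ, m_τ) = (3, 3)`. [H2-ZERO-ONE-7 §3] -/
theorem propC_Psi_typed (ss st : ℕ) (h : 1 ≤ ss ∨ 1 ≤ st) : 2 ≤ (3 - 1) * ss + 3 * st := by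
  omega

/-- THEOREM S, step (Z3) (report §4.1): the classes of the minimal generators of `F` in `M/𝔪M` span a subspace of sign-dimensions
`(m₊ − a₊, m₋ − a₋)`, so `μ_σ(F) ≥ m_σ − a_σ`; with `μ_σ(F) = 0` (Z2) and `a_σ ≤ m_σ` this forces `a_σ = m_σ`: every `σ`-generator of the hull is a
minimal generator of the torsion module. [H2-ZERO-ONE-7 §4.1] -/
theorem classZ_top (m a μ : ℕ) (h1 : m - a ≤ μ) (h2 : μ = 0) (h3 : a ≤ m) : a = m := by
  omega

/-- THEOREM S, remark 4.2 (iv): a class-Z module of Loewy length `2` would have `𝔪T₀ ⊂ soc ⊂ V_σ`, hence `n = n_τ = a_τ ≤ m_τ ≤ 3`; impossible for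
`n ≥ 4`. So class-Z torsion at a fixed point with `t_x ≥ 8` has Loewy length `≥ 3`. [H2-ZERO-ONE-7 §4.2] -/
theorem noLoewyTwo (n aτ mτ : ℕ) (h1 : aτ ≤ mτ) (h2 : mτ ≤ 3) (h3 : 4 ≤ n) (h : n = aτ) : False := by
  omega

/-- Report §5.1 (a), the decomposable class-Z sub-case on `M_𝔞` with `σ = +`: `T₀ = T′ ⊕ k₊^j`, `T′` of simple socle with sign-lengths `(n − j, n)`,
`a₊(T′) = 2 − j`, `a₋(T′) = am`; the crude bound `d ≥ P(T′) − j` with `P(T′) ≥ 2(n−j) + 3n − 2(n − j − (2 − j)) − 2(n − am) − (n − j)` simplifies to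
`4 − 2j + 2·am`. [H2-ZERO-ONE-7 §5.1] -/
theorem classZ_decomposable_plus (n j am : ℤ) :
    2 * (n - j) + 3 * n - 2 * (n - j - (2 - j)) - 2 * (n - am) - (n - j) - j = 4 - 2 * j + 2 * am := by
  ring

/-- Report §5.1 (a), the same with `σ = −`: `a₋(T′) = 3 − j`, `a₊(T′) = ap`; the crude bound simplifies to `6 − 3j + 2·ap` — `≥ 2` for `j = 1`, and
for `j = 2` iff `ap ≥ 1`; silent for `j = 3`. [H2-ZERO-ONE-7 §5.1] -/
theorem classZ_decomposable_minus (n j ap : ℤ) :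
    3 * (n - j) + 2 * n - 2 * (n - j - (3 - j)) - 2 * (n - ap) - (n - j) - j = 6 - 3 * j + 2 * ap := by
  ring

/-- Report §5.1 (a), the worked example where the crude count is silent but the true count is not: `n = 4`, `T₀ = (A/I)m ⊕ k₋²` with `A/I`
Gorenstein of Hilbert function `(1,4,1)` (a quotient of `M_𝔞` iff `s₂ ∈ 𝔪³`): the four relations impose `1 + 1 + 1 + 0 = 3` conditions on `5n = 20`
unknowns, `hom^ι = 17`; `end^ι = 2 + 2 + 2 + 4 = 10`; `d ≥ 7`. [H2-ZERO-ONE-7 §5.1] -/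
theorem example_141 : (5 : ℤ) * 4 - (1 + 1 + 1 + 0) = 17 ∧ (2 : ℤ) + 2 + 2 + 4 = 10 ∧ (17 : ℤ) - 10 = 7 := by
  norm_num

/-- Report §5.5, why no budget replaces 'all `n`': on the normal Gorenstein surface `S_a`, `χ(𝒪_{S_a}) = 14` (Koszul) and the resolution `S̃_a` has
maximal Albanese dimension, so `χ(𝒪_{S̃_a}) ≥ 0` (generic vanishing); Leray gives `χ(𝒪_{S_a}) = χ(𝒪_{S̃_a}) + Σ_w p_g(w)`, whence `Σ_w p_g(w) ≤ 14` —
a bound on the geometric genera of the singularities, far too weak to bound the torsion length usefully. [H2-ZERO-ONE-7 §5.5] -/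
theorem pg_budget (chiS chiSt spg : ℤ) (h1 : chiS = 14) (h2 : 0 ≤ chiSt) (h3 : chiS = chiSt + spg) : spg ≤ 14 := by
  linarith

/-- PROPOSITION R, enumerative frame (report §7.3 (ii)): the Harris–Tu class of the rank-`≤ 1` locus of a symmetric form on the rank-3 bundle
`g^*𝒬 ⊗ 𝒪(½)` on the pair incidence, `4(c₁c₂ − c₃) + 4c₁²l + 4c₂l + 8c₁l² + 4l³` with `c(𝒬) = 1 + H + H² + H³`, `l = H` (all classes in units of powers
of `H`), evaluates to `20·H³` — the same universal `20` as in THEOREM 2's `[D₁(Θ)]^{vir} = 20θ³`. [H2-ZERO-ONE-7 §7.3; Harris–Tu 1984] -/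
theorem harrisTu_on_pairs :
    4 * ((1 : ℚ) * 1 - 1) + 4 * 1 ^ 2 * 1 + 4 * 1 * 1 + 8 * 1 * 1 ^ 2 + 4 * 1 ^ 3 = 20 := by
  norm_num

/-- PROPOSITION R, enumerative frame (report §7.3 (ii)–(iii)): the Gauss map of a smooth theta divisor of a ppav fourfold has degree `4! = 24`; each
`u ∈ Θ` has `24 − 1 − 1 = 22` partners `v ≠ ±u` with the same Gauss image, so the closure `I‾` of the pair incidence has degree `24·23 − 24 = 528` over
`ℙ³`, and the virtual number of corank-`≥ 2` pairs is `20·528 = 10560` BEFORE removing the excess contribution of the fold divisor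
`∂ = {(u,u) : u ∈ Ram γ}` (not computed). [H2-ZERO-ONE-7 §7.3] -/
theorem pairIncidence_degree :
    Nat.factorial 4 = 24 ∧ (24 : ℕ) - 1 - 1 = 22 ∧ (24 : ℕ) * 23 - 24 = 528 ∧ 24 * 22 = 528 ∧ (20 : ℕ) * 528 = 10560 := by
  refine ⟨by decide, by norm_num, by norm_num, by norm_num, by norm_num⟩

/-- COROLLARY R, the cube (report §7.2): the polar map of `ℓ³` has rank `≤ 1` — for `C = x³`, `∂ₓC = 3x²` and `∂_yC = 0` are linearly dependent
(the non-trivial combination `0·∂ₓC + 1·∂_yC` vanishes identically); so a reduced point of the degeneracy scheme, whose polar map is injective,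
cannot have `C` a cube. [H2-ZERO-ONE-7 §7.2] -/
theorem binaryCubic_polar_cube : ∃ c : ℚ × ℚ, c ≠ 0 ∧ ∀ x y : ℚ, c.1 * (3 * x ^ 2) + c.2 * (0 * y) = 0 := by
  refine ⟨(0, 1), by simp, ?_⟩
  intro x y; ring

/-- COROLLARY R, two distinct roots, case `x²y` (report §7.2): the polars `∂ₓ(x²y) = 2xy`, `∂_y(x²y) = x²` are linearly independent — the polar
map `K → Sym²K^*` is injective — so the singularity `y₁² + x²y + …` is of type `D_k` (`k ≥ 5`), rational. [H2-ZERO-ONE-7 §7.2] -/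
theorem binaryCubic_polar_injective_x2y (a b : ℚ) (h : ∀ x y : ℚ, a * (2 * x * y) + b * x ^ 2 = 0) : a = 0 ∧ b = 0 := by
  have h1 := h 1 0
  have h2 := h 1 1
  constructor <;> nlinarith

/-- COROLLARY R, three distinct roots, case `xy(x+y)` (report §7.2): `∂ₓ = 2xy + y²`, `∂_y = x² + 2xy` are linearly independent (type `D₄`).
[H2-ZERO-ONE-7 §7.2] -/
theorem binaryCubic_polar_injective_D4 (a b : ℚ) (h : ∀ x y : ℚ, a * (2 * x * y + y ^ 2) + b * (x ^ 2 + 2 * x * y) = 0) :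
    a = 0 ∧ b = 0 := by
  have h1 := h 1 0
  have h2 := h 0 1
  constructor <;> nlinarith

/-- PROPOSITION R, the polar identity's three contributions (report §7.2 (b)): along `(k,k)` the tilt of the common tangent space contributes
`−4Q_u(k,t)β(t)`, the normalisation `−2β(k)Q_u(t,t)`, the cubic terms `3(C_v − C_u)(k,t,t)`; and the polar at `k` of the product `βQ_u` is
`β(k)Q_u(t,t) + 2β(t)Q_u(k,t)`, so the sum is `∂_k[(C_v − C_u) − 2βQ_u]`. The bilinear bookkeeping for `G₃ = C − 2βQ` with `C` a cubic form:
`3c − 4qb − 2bq' = 3c − 2(bq' + 2qb)` where `c = C(k,t,t)`, `q = Q(k,t)`, `b = β(t)`, `q' = Q(t,t)`, `b' := β(k)` (here written with `bq'` for `β(k)Q(t,t)`).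
[H2-ZERO-ONE-7 §7.2; machine-checked on 40 exact random instances, `polar_check.py`] -/
theorem polar_identity_bookkeeping (c q q' bk bt : ℚ) :
    3 * c - 4 * q * bt - 2 * bk * q' = 3 * c - 2 * (bk * q' + 2 * bt * q) := by
  ring

end H2QuotSieveAllN

end Summit.HodgeConjecture.HodgeConjecture.WeilTypeLadder
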